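import Summits.QuantumFields.YangMills.Theorems.InfiniteVolumeCentreBaseOn
import Summits.QuantumFields.YangMills.Theorems.BalabanLadderInfVolNontrivial
import Summits.QuantumFields.YangMills.Theorems.BalabanLadderInfVolFloorsDefs
import HarnessLib

/-!
# Infinite volume by compactness, class-parametric form III-a: the non-triviality ∕ non-Gaussianity clauses of the
# «`L → ∞` first» continuum data for ANY state family with volume-free floors and ceilings

HONEST FRAMING (cell `ym-fleet`, seat `ym-infvol-p2`, director-ym R136 (i); count-neutral helper for route
`InfiniteVolumeContinuum`, target stmt-QuantumFields-19927, and for the route owner's R85 §5b options (ii)∕(iv):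
under the spine's `ROT` rev 2′ the rotation leg is CLASS-LOCAL, so the route's DATA is read on infinite-volume states
chosen ALONG the tori of a class — the companion file `InfiniteVolumeContinuumDataOnNontrivial.lean` does that; this
file is the state-family-abstract NT ∕ NG engine it needs).  Pure soft analysis, kernel-checked.  The floors
(`LowerBoundsOn G r a 𝓢`) and the ceilings (`MomentBounds6On G r a 𝓢`) are HYPOTHESES (owed by the spine's cruxes
`NT` 19353 ∕ `UVSeamRec` 20043); the ROUTE is conditional on Track A's UV Prop `BalabanLadder.UV`; existence half
only; NOTHING is asserted about Bałaban's renormalisation group, uniqueness of the infinite-volume state, rotations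
(E1), a mass gap, or Clay.

WHAT IS PROVED ([folklore] throughout).
* §1 `twoPointNontrivial_of_eventually_floor`, `nonGaussian_of_eventually_floor` — the cores of p1's
  `twoPointNontrivial_of_lowerBoundsTL` ∕ `nonGaussian_of_lowerBoundsTL` (Theorems/BalabanLadderInfVolNontrivial.lean)
  with the floor as an EVENTUAL inequality along the sequence (state family irrelevant);
  `twoPointNontrivial_of_lowerBoundsOn`, `nonGaussian_of_lowerBoundsOn` — the same for the floors
  `LowerBoundsOn G r a 𝓢` of ANY `β`-indexed state family and states `μ_k ∈ 𝓢 (β_k)` (p1's are `𝓢 = oddTorusLimitPoints r`).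
* §2 `tendsto_q2State_of_data_on`, `tendsto_q3State_of_data_on` — from the route's DATA clause (plaquette-CENTRE
  smearing on `⁰𝒮`) for states of a family with volume-free ceilings `MomentBounds6On G r a 𝓢`,
  `𝓢 β ⊆ infiniteVolumeLimitPoints r.ρ β`: the complexified smeared truncated two-point sums
  `Q2State G r μ_k (a β_k) u v` converge to `S₁ 2 (u ⊗ v)` (`u` negative times, `v` positive times) and the smeared
  connected three-point sums `Q3State … f g h` to `S₁ 3 T₃` (pairwise disjoint supports) — p1's dictionary
  (`ofReal_q2State_eq_sum_tsum_tensor₂`, `ofReal_q3State_eq_sum_tsum`: the `Q`-sums ARE the orientation sums of the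
  BASE-POINT plane-string series) ∘ the seat's centre⇄base glue (`tendsto_base_of_tendsto_centre_on`).
* §3 `twoPointNontrivial_of_data_on`, `nonGaussian_of_data_on` — §1 ∘ §2: the SoftBundle-verbatim NT ∕ NG clauses of
  the route's leaf `OSExistenceFromInfiniteVolume` for ANY DATA tuple over a state family with floors AND ceilings
  (class-parametric: no parity, no oddness used).

References: K. Osterwalder, E. Seiler, Ann. Phys. 110 (1978) §2; K. Osterwalder, R. Schrader, CMP 31 (1973) §2;
S. Chatterjee, arXiv:1803.01950 §2; A. Jaffe, E. Witten (2006) §5–§6.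
-/

set_option autoImplicit false

noncomputable section

open scoped BigOperators SchwartzMap
open MeasureTheory Filter Topology
open Literature.MathematicalPhysics.QuantumFieldTheory hiding ZdEdge
open Literature.MathematicalPhysics.QuantumLattice
open Literature.MathematicalPhysics.AQFT
open Literature.Probability.LatticeModels (Site)
open Summit.QuantumFields.YangMills.Theorems.HypercubicLimit.Negative
  (tensor₂ isTensorOf_tensor₂ twoPointNontrivial_of_real isOffDiagonal_of_halfSpaces tsupport_thetaTest_neg)
open Summit.QuantumFields.YangMills.Theorems.OSLegsFromFemtoAndGap (isOffDiagonal_of_disjoint_three)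

namespace Summit.QuantumFields.YangMills.Theorems.InfiniteVolume

variable {G : Type} [Group G] [TopologicalSpace G] [IsTopologicalGroup G] [CompactSpace G]
  [MeasurableSpace G] [BorelSpace G]

/-- Membership in the finset of valid orientation strings means validity of every letter. [folklore] -/
theorem validString_of_mem_piFinset {n : ℕ} {q : Fin n → Fin 4 × Fin 4}
    (hq : q ∈ Fintype.piFinset (fun _ : Fin n => Finset.univ.filter fun p : Fin 4 × Fin 4 => p.1 < p.2)) (i : Fin n) :
    (q i).1 < (q i).2 :=
  (Finset.mem_filter.1 ((Fintype.mem_piFinset.1 hq) i)).2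

/-! ## §1 The NT ∕ NG clauses from an eventual floor along the sequence -/

/-- **Non-triviality from an eventual two-point floor.**  If `S₁ 1 = 0`, the complexified smeared truncated two-point
quantities `Q_k` converge to `S₁ 2 (θv ⊗ v)` for a real `v` supported in positive time, and eventually `ε ≤ Q_k` with
`ε > 0`, then the spine-shape non-triviality clause holds for `S₁.toLabelled` (`F₁ = θv∘θ`-tensor, `G₁ = v`,
`H₁ = θv ⊗ v`). [folklore] -/
theorem twoPointNontrivial_of_eventually_floor (S₁ : SchwingerFamily (EuclideanSpace ℝ (Fin 4)))
    (h1 : ∀ F : 𝓢((Fin 1 → EuclideanSpace ℝ (Fin 4)), ℂ), S₁ 1 F = 0)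
    {v : 𝓢(EuclideanSpace ℝ (Fin 4), ℝ)} (hv : tsupport v ⊆ {y : EuclideanSpace ℝ (Fin 4) | 0 < y 0})
    {ε : ℝ} (hε : 0 < ε) (Q : ℕ → ℝ) (hQ : ∀ᶠ k in atTop, ε ≤ Q k)
    (hconv : Tendsto (fun k => ((Q k : ℝ) : ℂ)) atTop (𝓝 (S₁ 2 (tensor₂ (thetaTest 4 v) v)))) :
    ∃ (F₁ G₁ : 𝓢((Fin 1 → EuclideanSpace ℝ (Fin 4)), ℂ)) (H₁ : 𝓢((Fin (1 + 1) → EuclideanSpace ℝ (Fin 4)), ℂ)),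
      IsTimeOrdered F₁ ∧ IsTimeOrdered G₁ ∧ IsAppendTensorOf H₁ (osAdjoint F₁) G₁ ∧
        S₁.toLabelled (1 + 1) (fun _ => ()) H₁ ≠
          S₁.toLabelled 1 (fun _ => ()) (osAdjoint F₁) * S₁.toLabelled 1 (fun _ => ()) G₁ := by
  have hu := tsupport_thetaTest_neg hv
  refine twoPointNontrivial_of_real S₁.toLabelled () hu hv ?_
  simp only [SchwingerFamily.toLabelled_apply, h1, mul_zero]
  have hre : Tendsto (fun k => (((Q k : ℝ) : ℂ)).re) atTop (𝓝 (S₁ 2 (tensor₂ (thetaTest 4 v) v)).re) :=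
    (Complex.continuous_re.tendsto _).comp hconv
  have hge : ε ≤ (S₁ 2 (tensor₂ (thetaTest 4 v) v)).re :=
    ge_of_tendsto hre (hQ.mono fun k hk => by rw [Complex.ofReal_re]; exact hk)
  intro h0
  have : (S₁ 2 (tensor₂ (thetaTest 4 v) v)).re = 0 := by
    rw [show S₁ 2 (tensor₂ (thetaTest 4 v) v) = 0 from h0, Complex.zero_re]
  linarith

/-- **Non-Gaussianity from an eventual three-point floor.**  If `S₁ 1 = 0`, the complexified smeared connected
three-point quantities `Q_k` converge to `S₁ 3 (f ⊗ g ⊗ h)` for real `f, g, h` with pairwise disjoint supports, and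
eventually `ε ≤ |Q_k|` with `ε > 0`, then the spine-shape non-Gaussianity clause holds for `S₁.toLabelled` (the eight
tensors are `tensorFin`s; with `S₁ 1 = 0` the cumulant combination is `S₁ 3 (f ⊗ g ⊗ h)`). [folklore] -/
theorem nonGaussian_of_eventually_floor (S₁ : SchwingerFamily (EuclideanSpace ℝ (Fin 4)))
    (h1 : ∀ F : 𝓢((Fin 1 → EuclideanSpace ℝ (Fin 4)), ℂ), S₁ 1 F = 0)
    {f g h : 𝓢(EuclideanSpace ℝ (Fin 4), ℝ)} (hfg : Disjoint (tsupport f) (tsupport g))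
    (hgh : Disjoint (tsupport g) (tsupport h)) (hfh : Disjoint (tsupport f) (tsupport h))
    {ε : ℝ} (hε : 0 < ε) (Q : ℕ → ℝ) (hQ : ∀ᶠ k in atTop, ε ≤ |Q k|)
    (hconv : Tendsto (fun k => ((Q k : ℝ) : ℂ)) atTop
      (𝓝 (S₁ 3 (SchwartzMap.tensorFin 3 ![ofRealTest f, ofRealTest g, ofRealTest h])))) :
    ∃ (f g h : 𝓢(EuclideanSpace ℝ (Fin 4), ℂ)) (Ffgh : 𝓢((Fin 3 → EuclideanSpace ℝ (Fin 4)), ℂ))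
      (Fgh Ffh Ffg : 𝓢((Fin 2 → EuclideanSpace ℝ (Fin 4)), ℂ)) (Ff Fg Fh : 𝓢((Fin 1 → EuclideanSpace ℝ (Fin 4)), ℂ)),
      IsTensorOf Ffgh ![f, g, h] ∧ IsOffDiagonal Ffgh ∧ IsTensorOf Fgh ![g, h] ∧
      IsTensorOf Ffh ![f, h] ∧ IsTensorOf Ffg ![f, g] ∧ IsTensorOf Ff ![f] ∧ IsTensorOf Fg ![g] ∧
      IsTensorOf Fh ![h] ∧
        S₁.toLabelled 3 (fun _ => ()) Ffgh - S₁.toLabelled 1 (fun _ => ()) Ff * S₁.toLabelled 2 (fun _ => ()) Fgh -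
          S₁.toLabelled 1 (fun _ => ()) Fg * S₁.toLabelled 2 (fun _ => ()) Ffh -
          S₁.toLabelled 1 (fun _ => ()) Fh * S₁.toLabelled 2 (fun _ => ()) Ffg +
          2 * (S₁.toLabelled 1 (fun _ => ()) Ff * S₁.toLabelled 1 (fun _ => ()) Fg *
            S₁.toLabelled 1 (fun _ => ()) Fh) ≠ 0 := by
  set T3 : 𝓢((Fin 3 → EuclideanSpace ℝ (Fin 4)), ℂ) :=
    SchwartzMap.tensorFin 3 ![ofRealTest f, ofRealTest g, ofRealTest h]
  have hT3 : IsTensorOf T3 ![ofRealTest f, ofRealTest g, ofRealTest h] := isTensorOf_tensorFin _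
  have hod : IsOffDiagonal T3 := isOffDiagonal_of_disjoint_three hfg hgh hfh hT3
  refine ⟨ofRealTest f, ofRealTest g, ofRealTest h, T3,
    SchwartzMap.tensorFin 2 ![ofRealTest g, ofRealTest h], SchwartzMap.tensorFin 2 ![ofRealTest f, ofRealTest h],
    SchwartzMap.tensorFin 2 ![ofRealTest f, ofRealTest g], SchwartzMap.tensorFin 1 ![ofRealTest f],
    SchwartzMap.tensorFin 1 ![ofRealTest g], SchwartzMap.tensorFin 1 ![ofRealTest h], hT3, hod,
    isTensorOf_tensorFin _, isTensorOf_tensorFin _, isTensorOf_tensorFin _, isTensorOf_tensorFin _,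
    isTensorOf_tensorFin _, isTensorOf_tensorFin _, ?_⟩
  simp only [SchwingerFamily.toLabelled_apply, h1, zero_mul, sub_zero, mul_zero, add_zero]
  have hnorm : Tendsto (fun k => ‖((Q k : ℝ) : ℂ)‖) atTop (𝓝 ‖S₁ 3 T3‖) := (continuous_norm.tendsto _).comp hconv
  have hge : ε ≤ ‖S₁ 3 T3‖ :=
    ge_of_tendsto hnorm (hQ.mono fun k hk => by rw [Complex.norm_real, Real.norm_eq_abs]; exact hk)
  intro h0
  rw [h0, norm_zero] at hge
  linarith

/-- **Non-triviality from the volume-free floor (i) of ANY state family.**  Couplings `β_k → ∞`, states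
`μ_k ∈ 𝓢 (β_k)`, `S₁ 1 = 0`, and the complexified `Q2State G r μ_k (a β_k) u v → S₁ 2 (u ⊗ v)` for real `u`
(negative times), `v` (positive times): then the floor `ε ≤ Q2State μ (a β) (θv) v` (`β ≥ β₅`, `μ ∈ 𝓢 β`) gives the
NT clause.  (p1's `twoPointNontrivial_of_lowerBoundsTL` is the case `𝓢 = oddTorusLimitPoints r`.) [folklore] -/
theorem twoPointNontrivial_of_lowerBoundsOn (r : LatticeRep G) {a : ℝ → ℝ} {𝓢 : ℝ → Set (Measure (LGConfig 4 G))}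
    (hLB : ∃ (v : 𝓢(EuclideanSpace ℝ (Fin 4), ℝ)) (ε β₅ : ℝ),
      tsupport v ⊆ {y : EuclideanSpace ℝ (Fin 4) | 0 < y 0} ∧ 0 < ε ∧
        ∀ β : ℝ, β₅ ≤ β → ∀ μ ∈ 𝓢 β, ε ≤ Q2State G r μ (a β) (thetaTest 4 v) v)
    (β : ℕ → ℝ) (hβ : Tendsto β atTop atTop) (μ : ℕ → Measure (LGConfig 4 G)) (hμ : ∀ k, μ k ∈ 𝓢 (β k))
    (S₁ : SchwingerFamily (EuclideanSpace ℝ (Fin 4)))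
    (h1 : ∀ F : 𝓢((Fin 1 → EuclideanSpace ℝ (Fin 4)), ℂ), S₁ 1 F = 0)
    (hconv : ∀ u v : 𝓢(EuclideanSpace ℝ (Fin 4), ℝ), tsupport u ⊆ {y : EuclideanSpace ℝ (Fin 4) | y 0 < 0} →
      tsupport v ⊆ {y : EuclideanSpace ℝ (Fin 4) | 0 < y 0} →
        Tendsto (fun k => ((Q2State G r (μ k) (a (β k)) u v : ℝ) : ℂ)) atTop (𝓝 (S₁ 2 (tensor₂ u v)))) :
    ∃ (F₁ G₁ : 𝓢((Fin 1 → EuclideanSpace ℝ (Fin 4)), ℂ)) (H₁ : 𝓢((Fin (1 + 1) → EuclideanSpace ℝ (Fin 4)), ℂ)),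
      IsTimeOrdered F₁ ∧ IsTimeOrdered G₁ ∧ IsAppendTensorOf H₁ (osAdjoint F₁) G₁ ∧
        S₁.toLabelled (1 + 1) (fun _ => ()) H₁ ≠
          S₁.toLabelled 1 (fun _ => ()) (osAdjoint F₁) * S₁.toLabelled 1 (fun _ => ()) G₁ := by
  obtain ⟨v, ε, β₅, hv, hε, hQ⟩ := hLB
  refine twoPointNontrivial_of_eventually_floor S₁ h1 hv hε
    (fun k => Q2State G r (μ k) (a (β k)) (thetaTest 4 v) v) ?_ (hconv _ v (tsupport_thetaTest_neg hv) hv)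
  filter_upwards [hβ.eventually_ge_atTop β₅] with k hk
  exact hQ _ hk _ (hμ k)

/-- **Non-Gaussianity from the volume-free floor (ii) of ANY state family.**  With `S₁ 1 = 0` and the complexified
`Q3State G r μ_k (a β_k) f g h → S₁ 3 T₃` for every tensor `T₃` of real `f, g, h` with pairwise disjoint supports, the
floor `ε ≤ |Q3State μ (a β) f g h|` (`β ≥ β₅`, `μ ∈ 𝓢 β`) gives the NG clause.  (p1's `nonGaussian_of_lowerBoundsTL`
is the case `𝓢 = oddTorusLimitPoints r`.) [folklore] -/
theorem nonGaussian_of_lowerBoundsOn (r : LatticeRep G) {a : ℝ → ℝ} {𝓢 : ℝ → Set (Measure (LGConfig 4 G))}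
    (hLB : ∃ (f g h : 𝓢(EuclideanSpace ℝ (Fin 4), ℝ)) (ε β₅ : ℝ), Disjoint (tsupport f) (tsupport g) ∧
      Disjoint (tsupport g) (tsupport h) ∧ Disjoint (tsupport f) (tsupport h) ∧ 0 < ε ∧
      ∀ β : ℝ, β₅ ≤ β → ∀ μ ∈ 𝓢 β, ε ≤ |Q3State G r μ (a β) f g h|)
    (β : ℕ → ℝ) (hβ : Tendsto β atTop atTop) (μ : ℕ → Measure (LGConfig 4 G)) (hμ : ∀ k, μ k ∈ 𝓢 (β k))
    (S₁ : SchwingerFamily (EuclideanSpace ℝ (Fin 4)))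
    (h1 : ∀ F : 𝓢((Fin 1 → EuclideanSpace ℝ (Fin 4)), ℂ), S₁ 1 F = 0)
    (hconv : ∀ (f g h : 𝓢(EuclideanSpace ℝ (Fin 4), ℝ)) (T₃ : 𝓢((Fin 3 → EuclideanSpace ℝ (Fin 4)), ℂ)),
      Disjoint (tsupport f) (tsupport g) → Disjoint (tsupport g) (tsupport h) → Disjoint (tsupport f) (tsupport h) →
      IsTensorOf T₃ ![ofRealTest f, ofRealTest g, ofRealTest h] →
        Tendsto (fun k => ((Q3State G r (μ k) (a (β k)) f g h : ℝ) : ℂ)) atTop (𝓝 (S₁ 3 T₃))) :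
    ∃ (f g h : 𝓢(EuclideanSpace ℝ (Fin 4), ℂ)) (Ffgh : 𝓢((Fin 3 → EuclideanSpace ℝ (Fin 4)), ℂ))
      (Fgh Ffh Ffg : 𝓢((Fin 2 → EuclideanSpace ℝ (Fin 4)), ℂ)) (Ff Fg Fh : 𝓢((Fin 1 → EuclideanSpace ℝ (Fin 4)), ℂ)),
      IsTensorOf Ffgh ![f, g, h] ∧ IsOffDiagonal Ffgh ∧ IsTensorOf Fgh ![g, h] ∧
      IsTensorOf Ffh ![f, h] ∧ IsTensorOf Ffg ![f, g] ∧ IsTensorOf Ff ![f] ∧ IsTensorOf Fg ![g] ∧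
      IsTensorOf Fh ![h] ∧
        S₁.toLabelled 3 (fun _ => ()) Ffgh - S₁.toLabelled 1 (fun _ => ()) Ff * S₁.toLabelled 2 (fun _ => ()) Fgh -
          S₁.toLabelled 1 (fun _ => ()) Fg * S₁.toLabelled 2 (fun _ => ()) Ffh -
          S₁.toLabelled 1 (fun _ => ()) Fh * S₁.toLabelled 2 (fun _ => ()) Ffg +
          2 * (S₁.toLabelled 1 (fun _ => ()) Ff * S₁.toLabelled 1 (fun _ => ()) Fg *
            S₁.toLabelled 1 (fun _ => ()) Fh) ≠ 0 := by
  obtain ⟨f, g, h, ε, β₅, hfg, hgh, hfh, hε, hQ⟩ := hLB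
  refine nonGaussian_of_eventually_floor S₁ h1 hfg hgh hfh hε (fun k => Q3State G r (μ k) (a (β k)) f g h) ?_
    (hconv f g h _ hfg hgh hfh (isTensorOf_tensorFin _))
  filter_upwards [hβ.eventually_ge_atTop β₅] with k hk
  exact hQ _ hk _ (hμ k)

/-! ## §2 `Q2State` ∕ `Q3State` converge to `S₁ 2` ∕ `S₁ 3` under the DATA clause (state family abstract) -/

/-- **The smeared truncated two-point sums converge to `S₁ 2 (u ⊗ v)` under the DATA clause.**  States `μ_k ∈ 𝓢 (β_k)`
of a family with volume-free ceilings `MomentBounds6On G r a 𝓢`, `𝓢 β ⊆ infiniteVolumeLimitPoints r.ρ β`, couplings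
`β_k → ∞`, `a > 0`, `a → 0`; `S₁ 2 = Σ_{q valid} T 2 q` and convergence of the plaquette-CENTRE-smeared plane-string
series to `T n q` on `⁰𝒮ₙ`.  Then for real `u` (negative times), `v` (positive times):
`(Q2State G r μ_k (a β_k) u v : ℂ) → S₁ 2 (u ⊗ v)` — dictionary `ofReal_q2State_eq_sum_tsum_tensor₂` (base points)
and the centre⇄base glue `tendsto_base_of_tendsto_centre_on` (`u ⊗ v ∈ ⁰𝒮₂`). [folklore] -/
theorem tendsto_q2State_of_data_on (r : LatticeRep G) {a : ℝ → ℝ} (hapos : ∀ β, 0 < a β)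
    (ha0 : Tendsto a atTop (𝓝 0)) {𝓢 : ℝ → Set (Measure (LGConfig 4 G))} (hMB : MomentBounds6On G r a 𝓢)
    (h𝓢 : ∀ β, 𝓢 β ⊆ infiniteVolumeLimitPoints (d := 4) r.ρ β)
    (β : ℕ → ℝ) (hβ : Tendsto β atTop atTop) (μ : ℕ → Measure (LGConfig 4 G)) (hμ : ∀ k, μ k ∈ 𝓢 (β k))
    (S₁ : SchwingerFamily (EuclideanSpace ℝ (Fin 4)))
    (T : (n : ℕ) → (Fin n → Fin 4 × Fin 4) → (𝓢((Fin n → EuclideanSpace ℝ (Fin 4)), ℂ) →L[ℂ] ℂ))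
    (hS : ∀ n : ℕ, 2 ≤ n → ∀ F : 𝓢((Fin n → EuclideanSpace ℝ (Fin 4)), ℂ),
      S₁ n F = ∑ q ∈ Fintype.piFinset (fun _ : Fin n => Finset.univ.filter fun p : Fin 4 × Fin 4 => p.1 < p.2),
        T n q F)
    (hT : ∀ n : ℕ, 2 ≤ n → ∀ q : Fin n → Fin 4 × Fin 4, (∀ i, (q i).1 < (q i).2) →
      ∀ F : 𝓢((Fin n → EuclideanSpace ℝ (Fin 4)), ℂ), IsOffDiagonal F →
        Tendsto (fun k => ∑' x : Fin n → (Fin 4 → ℤ), ((stateMomentStr G r (μ k) n q x : ℝ) : ℂ) *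
          F (fun l => a (β k) • siteToE (x l) +
            (a (β k) / 2) • (EuclideanSpace.single (q l).1 (1 : ℝ) + EuclideanSpace.single (q l).2 (1 : ℝ))))
          atTop (𝓝 (T n q F)))
    (u v : 𝓢(EuclideanSpace ℝ (Fin 4), ℝ)) (hu : tsupport u ⊆ {y : EuclideanSpace ℝ (Fin 4) | y 0 < 0})
    (hv : tsupport v ⊆ {y : EuclideanSpace ℝ (Fin 4) | 0 < y 0}) :
    Tendsto (fun k => ((Q2State G r (μ k) (a (β k)) u v : ℝ) : ℂ)) atTop (𝓝 (S₁ 2 (tensor₂ u v))) := by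
  haveI : ∀ k, IsProbabilityMeasure (μ k) := fun k => by
    obtain ⟨N, -, hlim⟩ := h𝓢 (β k) (hμ k)
    exact hlim.1
  have hod : IsOffDiagonal (tensor₂ u v) := isOffDiagonal_of_halfSpaces hu hv (isTensorOf_tensor₂ u v)
  have hfun : (fun k => ((Q2State G r (μ k) (a (β k)) u v : ℝ) : ℂ)) = fun k =>
      ∑ Q ∈ Fintype.piFinset (fun _ : Fin 2 => Finset.univ.filter (fun q : Fin 4 × Fin 4 => q.1 < q.2)),
        ∑' x : Fin 2 → Site 4, ((stateMomentStr G r (μ k) 2 Q x : ℝ) : ℂ) *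
          tensor₂ u v (fun l => a (β k) • siteToE (x l)) :=
    funext fun k => ofReal_q2State_eq_sum_tsum_tensor₂ r (μ k) (hapos (β k)) u v
  rw [hS 2 le_rfl, hfun]
  exact tendsto_finsetSum _ fun Q hQ =>
    tendsto_base_of_tendsto_centre_on r hapos ha0 hMB β hβ μ hμ le_rfl Q (validString_of_mem_piFinset hQ) _ hod
      (hT 2 le_rfl Q (validString_of_mem_piFinset hQ) _ hod)

/-- **The smeared connected three-point sums converge to `S₁ 3 T₃` under the DATA clause**, for every tensor `T₃` of
real `f, g, h` with pairwise disjoint supports (`T₃ ∈ ⁰𝒮₃` by `isOffDiagonal_of_disjoint_three`); same mechanism as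
`tendsto_q2State_of_data_on` with the dictionary `ofReal_q3State_eq_sum_tsum`. [folklore] -/
theorem tendsto_q3State_of_data_on (r : LatticeRep G) {a : ℝ → ℝ} (hapos : ∀ β, 0 < a β)
    (ha0 : Tendsto a atTop (𝓝 0)) {𝓢 : ℝ → Set (Measure (LGConfig 4 G))} (hMB : MomentBounds6On G r a 𝓢)
    (h𝓢 : ∀ β, 𝓢 β ⊆ infiniteVolumeLimitPoints (d := 4) r.ρ β)
    (β : ℕ → ℝ) (hβ : Tendsto β atTop atTop) (μ : ℕ → Measure (LGConfig 4 G)) (hμ : ∀ k, μ k ∈ 𝓢 (β k))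
    (S₁ : SchwingerFamily (EuclideanSpace ℝ (Fin 4)))
    (T : (n : ℕ) → (Fin n → Fin 4 × Fin 4) → (𝓢((Fin n → EuclideanSpace ℝ (Fin 4)), ℂ) →L[ℂ] ℂ))
    (hS : ∀ n : ℕ, 2 ≤ n → ∀ F : 𝓢((Fin n → EuclideanSpace ℝ (Fin 4)), ℂ),
      S₁ n F = ∑ q ∈ Fintype.piFinset (fun _ : Fin n => Finset.univ.filter fun p : Fin 4 × Fin 4 => p.1 < p.2),
        T n q F)
    (hT : ∀ n : ℕ, 2 ≤ n → ∀ q : Fin n → Fin 4 × Fin 4, (∀ i, (q i).1 < (q i).2) →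
      ∀ F : 𝓢((Fin n → EuclideanSpace ℝ (Fin 4)), ℂ), IsOffDiagonal F →
        Tendsto (fun k => ∑' x : Fin n → (Fin 4 → ℤ), ((stateMomentStr G r (μ k) n q x : ℝ) : ℂ) *
          F (fun l => a (β k) • siteToE (x l) +
            (a (β k) / 2) • (EuclideanSpace.single (q l).1 (1 : ℝ) + EuclideanSpace.single (q l).2 (1 : ℝ))))
          atTop (𝓝 (T n q F)))
    (f g h : 𝓢(EuclideanSpace ℝ (Fin 4), ℝ)) (T₃ : 𝓢((Fin 3 → EuclideanSpace ℝ (Fin 4)), ℂ))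
    (hfg : Disjoint (tsupport f) (tsupport g)) (hgh : Disjoint (tsupport g) (tsupport h))
    (hfh : Disjoint (tsupport f) (tsupport h)) (hT₃ : IsTensorOf T₃ ![ofRealTest f, ofRealTest g, ofRealTest h]) :
    Tendsto (fun k => ((Q3State G r (μ k) (a (β k)) f g h : ℝ) : ℂ)) atTop (𝓝 (S₁ 3 T₃)) := by
  haveI : ∀ k, IsProbabilityMeasure (μ k) := fun k => by
    obtain ⟨N, -, hlim⟩ := h𝓢 (β k) (hμ k)
    exact hlim.1
  have hod : IsOffDiagonal T₃ := isOffDiagonal_of_disjoint_three hfg hgh hfh hT₃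
  have hfun : (fun k => ((Q3State G r (μ k) (a (β k)) f g h : ℝ) : ℂ)) = fun k =>
      ∑ Q ∈ Fintype.piFinset (fun _ : Fin 3 => Finset.univ.filter (fun q : Fin 4 × Fin 4 => q.1 < q.2)),
        ∑' x : Fin 3 → Site 4, ((stateMomentStr G r (μ k) 3 Q x : ℝ) : ℂ) * T₃ (fun l => a (β k) • siteToE (x l)) :=
    funext fun k => ofReal_q3State_eq_sum_tsum r (μ k) (hapos (β k)) f g h T₃ hT₃
  rw [hS 3 (by norm_num), hfun]
  exact tendsto_finsetSum _ fun Q hQ =>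
    tendsto_base_of_tendsto_centre_on r hapos ha0 hMB β hβ μ hμ (by norm_num) Q (validString_of_mem_piFinset hQ) _
      hod (hT 3 (by norm_num) Q (validString_of_mem_piFinset hQ) _ hod)

/-! ## §3 The NT ∕ NG clauses of the route's leaf for ANY DATA tuple over a family with floors and ceilings -/

/-- **Non-triviality of the «`L → ∞` first» continuum data, state family abstract**: `a > 0`, `a → 0`,
`MomentBounds6On G r a 𝓢`, `LowerBoundsOn G r a 𝓢`, `𝓢 β ⊆ infiniteVolumeLimitPoints r.ρ β`; any couplings
`β_k → ∞`, states `μ_k ∈ 𝓢 (β_k)` and `(S₁, T)` with `S₁ 1 = 0`, `S₁ n = Σ_q T n q` and the DATA-clause convergence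
(centre smearing) satisfy the NT clause of `OSExistenceFromInfiniteVolume` VERBATIM. [folklore] -/
theorem twoPointNontrivial_of_data_on (r : LatticeRep G) {a : ℝ → ℝ} (hapos : ∀ β, 0 < a β)
    (ha0 : Tendsto a atTop (𝓝 0)) {𝓢 : ℝ → Set (Measure (LGConfig 4 G))} (hMB : MomentBounds6On G r a 𝓢)
    (hLB : LowerBoundsOn G r a 𝓢) (h𝓢 : ∀ β, 𝓢 β ⊆ infiniteVolumeLimitPoints (d := 4) r.ρ β)
    (β : ℕ → ℝ) (hβ : Tendsto β atTop atTop) (μ : ℕ → Measure (LGConfig 4 G)) (hμ : ∀ k, μ k ∈ 𝓢 (β k))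
    (S₁ : SchwingerFamily (EuclideanSpace ℝ (Fin 4)))
    (T : (n : ℕ) → (Fin n → Fin 4 × Fin 4) → (𝓢((Fin n → EuclideanSpace ℝ (Fin 4)), ℂ) →L[ℂ] ℂ))
    (h1 : ∀ F : 𝓢((Fin 1 → EuclideanSpace ℝ (Fin 4)), ℂ), S₁ 1 F = 0)
    (hS : ∀ n : ℕ, 2 ≤ n → ∀ F : 𝓢((Fin n → EuclideanSpace ℝ (Fin 4)), ℂ),
      S₁ n F = ∑ q ∈ Fintype.piFinset (fun _ : Fin n => Finset.univ.filter fun p : Fin 4 × Fin 4 => p.1 < p.2),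
        T n q F)
    (hT : ∀ n : ℕ, 2 ≤ n → ∀ q : Fin n → Fin 4 × Fin 4, (∀ i, (q i).1 < (q i).2) →
      ∀ F : 𝓢((Fin n → EuclideanSpace ℝ (Fin 4)), ℂ), IsOffDiagonal F →
        Tendsto (fun k => ∑' x : Fin n → (Fin 4 → ℤ), ((stateMomentStr G r (μ k) n q x : ℝ) : ℂ) *
          F (fun l => a (β k) • siteToE (x l) +
            (a (β k) / 2) • (EuclideanSpace.single (q l).1 (1 : ℝ) + EuclideanSpace.single (q l).2 (1 : ℝ))))
          atTop (𝓝 (T n q F))) :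
    ∃ (F₁ G₁ : 𝓢((Fin 1 → EuclideanSpace ℝ (Fin 4)), ℂ)) (H₁ : 𝓢((Fin (1 + 1) → EuclideanSpace ℝ (Fin 4)), ℂ)),
      IsTimeOrdered F₁ ∧ IsTimeOrdered G₁ ∧ IsAppendTensorOf H₁ (osAdjoint F₁) G₁ ∧
        S₁.toLabelled (1 + 1) (fun _ => ()) H₁ ≠
          S₁.toLabelled 1 (fun _ => ()) (osAdjoint F₁) * S₁.toLabelled 1 (fun _ => ()) G₁ :=
  twoPointNontrivial_of_lowerBoundsOn r hLB.1 β hβ μ hμ S₁ h1 fun u v hu hv =>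
    tendsto_q2State_of_data_on r hapos ha0 hMB h𝓢 β hβ μ hμ S₁ T hS hT u v hu hv

/-- **Non-Gaussianity of the «`L → ∞` first» continuum data, state family abstract** (hypotheses as in
`twoPointNontrivial_of_data_on`): the NG clause of `OSExistenceFromInfiniteVolume` VERBATIM. [folklore] -/
theorem nonGaussian_of_data_on (r : LatticeRep G) {a : ℝ → ℝ} (hapos : ∀ β, 0 < a β)
    (ha0 : Tendsto a atTop (𝓝 0)) {𝓢 : ℝ → Set (Measure (LGConfig 4 G))} (hMB : MomentBounds6On G r a 𝓢)
    (hLB : LowerBoundsOn G r a 𝓢) (h𝓢 : ∀ β, 𝓢 β ⊆ infiniteVolumeLimitPoints (d := 4) r.ρ β)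
    (β : ℕ → ℝ) (hβ : Tendsto β atTop atTop) (μ : ℕ → Measure (LGConfig 4 G)) (hμ : ∀ k, μ k ∈ 𝓢 (β k))
    (S₁ : SchwingerFamily (EuclideanSpace ℝ (Fin 4)))
    (T : (n : ℕ) → (Fin n → Fin 4 × Fin 4) → (𝓢((Fin n → EuclideanSpace ℝ (Fin 4)), ℂ) →L[ℂ] ℂ))
    (h1 : ∀ F : 𝓢((Fin 1 → EuclideanSpace ℝ (Fin 4)), ℂ), S₁ 1 F = 0)
    (hS : ∀ n : ℕ, 2 ≤ n → ∀ F : 𝓢((Fin n → EuclideanSpace ℝ (Fin 4)), ℂ),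
      S₁ n F = ∑ q ∈ Fintype.piFinset (fun _ : Fin n => Finset.univ.filter fun p : Fin 4 × Fin 4 => p.1 < p.2),
        T n q F)
    (hT : ∀ n : ℕ, 2 ≤ n → ∀ q : Fin n → Fin 4 × Fin 4, (∀ i, (q i).1 < (q i).2) →
      ∀ F : 𝓢((Fin n → EuclideanSpace ℝ (Fin 4)), ℂ), IsOffDiagonal F →
        Tendsto (fun k => ∑' x : Fin n → (Fin 4 → ℤ), ((stateMomentStr G r (μ k) n q x : ℝ) : ℂ) *
          F (fun l => a (β k) • siteToE (x l) +
            (a (β k) / 2) • (EuclideanSpace.single (q l).1 (1 : ℝ) + EuclideanSpace.single (q l).2 (1 : ℝ))))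
          atTop (𝓝 (T n q F))) :
    ∃ (f g h : 𝓢(EuclideanSpace ℝ (Fin 4), ℂ)) (Ffgh : 𝓢((Fin 3 → EuclideanSpace ℝ (Fin 4)), ℂ))
      (Fgh Ffh Ffg : 𝓢((Fin 2 → EuclideanSpace ℝ (Fin 4)), ℂ)) (Ff Fg Fh : 𝓢((Fin 1 → EuclideanSpace ℝ (Fin 4)), ℂ)),
      IsTensorOf Ffgh ![f, g, h] ∧ IsOffDiagonal Ffgh ∧ IsTensorOf Fgh ![g, h] ∧
      IsTensorOf Ffh ![f, h] ∧ IsTensorOf Ffg ![f, g] ∧ IsTensorOf Ff ![f] ∧ IsTensorOf Fg ![g] ∧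
      IsTensorOf Fh ![h] ∧
        S₁.toLabelled 3 (fun _ => ()) Ffgh - S₁.toLabelled 1 (fun _ => ()) Ff * S₁.toLabelled 2 (fun _ => ()) Fgh -
          S₁.toLabelled 1 (fun _ => ()) Fg * S₁.toLabelled 2 (fun _ => ()) Ffh -
          S₁.toLabelled 1 (fun _ => ()) Fh * S₁.toLabelled 2 (fun _ => ()) Ffg +
          2 * (S₁.toLabelled 1 (fun _ => ()) Ff * S₁.toLabelled 1 (fun _ => ()) Fg *
            S₁.toLabelled 1 (fun _ => ()) Fh) ≠ 0 :=
  nonGaussian_of_lowerBoundsOn r hLB.2 β hβ μ hμ S₁ h1 fun f g h T₃ hfg hgh hfh hT₃ =>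
    tendsto_q3State_of_data_on r hapos ha0 hMB h𝓢 β hβ μ hμ S₁ T hS hT f g h T₃ hfg hgh hfh hT₃

end Summit.QuantumFields.YangMills.Theorems.InfiniteVolume

end
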